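import Summits.NavierStokesRegularity.NavierStokesRegularity.Theorems.FilamentSkeletonRssCoreLinearInvertibilityOddArnoldToolsA
import Summits.NavierStokesRegularity.NavierStokesRegularity.Theorems.FilamentSkeletonRssCoreLinearInvertibilityOddArnoldToolsB
import Summits.AnomalousDissipation.AnomalousDissipation.Theorems.MarginalStabilityChainStretchedVortexRowsStubCoreRotationCoercivity
import Literature.Analysis.FluidPDE.GaussianVortexKernelRadial
import Literature.Analysis.FluidPDE.PlanarPolarCoords

/-!
# Tools for stub `stub_evenSymmetrizerBoundedBelow` (crux `CoreLinearInvertibility`,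
# stmt-NavierStokesRegularity-17973, route `FilamentSkeletonRss`, line `Sketch`):
# EXPLICIT coercivity of Arnold's quadratic form at the Gaussian vortex on EVEN densities with
# zero circular means (angular modes `|k| ≥ 2`)

For a `C¹` density `a` on `ℝ²` of Gaussian class (`|a|, ‖Da‖ ≤ C(1+|x|)^N e^{−|x|²/4}`) which is
EVEN (`a(−x) = a(x)`) and has ZERO CIRCULAR MEANS (`∫_{−π}^{π} a(r cos θ, r sin θ) dθ = 0`, `r > 0`),
with logarithmic potential `ψ_a = N ∗ a`, `N = (2π)⁻¹ log ‖·‖`, and the Gaussian kernel weight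
`Φ = kerWeight`, `Φ(r) = (r²/4)/(e^{r²/4} − 1)` (so that `𝒜 = Φ⁻¹` is the Gallay–Šverák weight of
Arnold's form `2J(a) = ∫ Φ⁻¹ a² + ∫ a ψ_a` at the Lamb–Oseen vortex):

* `a` is neutral (`∫ a = 0`, polar coordinates), so `‖∇ψ_a‖² ∈ L¹` and `∫ ‖∇ψ_a‖² = −∫ ψ_a a`
  (tree `logPotential_neutral_energy`), and `ψ_a` is `C¹`, even, with zero circular means;
* Hardy–Wirtinger for even circular-mean-free functions (tree `hardyWirtinger_even`):
  `∫ ψ_a²/|x|² ≤ ¼ ∫ ‖∇ψ_a‖²`;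
* the scalar bound `Φ(|x|)|x|² = 4s²/(eˢ − 1) ≤ 14/5` (`s = |x|²/4`, tree
  `sq_le_seven_tenths_mul_exp_sub_one`);
* hence `‖∇ψ_a‖² = −∫ ψ_a a ≤ 2∫ ψ_a²/|x|² + ⅛∫ |x|² a² ≤ ½‖∇ψ_a‖² + (7/20) ∫ Φ⁻¹ a²`, i.e.
  `‖∇ψ_a‖² ≤ (7/10) ∫ Φ⁻¹ a²` and **`2J(a) = ∫ Φ⁻¹ a² + ∫ a ψ_a ≥ (3/10) ∫ Φ⁻¹ a²`**
  (`evenArnold_coercive`);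
* consequently, if `F = a + Φ ψ_a = (I − K̃)a` (`K̃a = −Φψ_a`) is a measurable Gaussian-class
  function, `‖a‖_{L²(Φ⁻¹)} ≤ (10/3) ‖F‖_{L²(Φ⁻¹)}` (`evenArnold_kerNorm_le`, weighted Cauchy–Schwarz).

This is the even (`|k| ≥ 2`) counterpart, with an explicit constant, of Gallay–Šverák's Theorem 2.5;
no literature fact is used.

References: Th. Gallay, V. Šverák, arXiv:2110.13739, §2, Thm. 2.5, §4.1 (the form `J`, the weight
`𝒜 = 1/Φ`); Th. Gallay, C. E. Wayne, Comm. Math. Phys. 255 (2005) §4.1 and Th. Gallay, Y. Maekawa,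
arXiv:1610.08384 §4.1 (Hardy-type inequalities for functions without low angular modes). Folklore.
-/

set_option linter.dupNamespace false

noncomputable section

namespace Summit.NavierStokesRegularity.NavierStokesRegularity.Theorems

open Set Function Filter MeasureTheory Topology Metric
open Literature.Analysis.FluidPDE
open Summit.AnomalousDissipation.AnomalousDissipation.Theorems.MarginalStabilityChainStretchedVortexRows
open scoped InnerProductSpace

/-! ### The scalar bound `Φ(|x|) |x|² ≤ 14/5` -/

/-- `Φ(|x|)|x|² = 4s²/(eˢ − 1) ≤ 4 · (7/10) = 14/5`, `s = |x|²/4`. [folklore] -/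
theorem evenArnold_kerWeight_mul_sq_le (ξ : EuclideanSpace ℝ (Fin 2)) :
    kerWeight ‖ξ‖ * ‖ξ‖ ^ 2 ≤ 14 / 5 := by
  by_cases hξ : ξ = 0
  · subst hξ; norm_num
  have hr : 0 < ‖ξ‖ := norm_pos_iff.2 hξ
  rw [kerWeight_eq hr.ne']
  set x : ℝ := ‖ξ‖ ^ 2 / 4 with hx
  have hx0 : 0 < x := by positivity
  have hr2 : ‖ξ‖ ^ 2 = 4 * x := by rw [hx]; ring
  have hkey := sq_le_seven_tenths_mul_exp_sub_one hx0.le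
  have hden : 0 < Real.exp x - 1 := by
    have := Real.add_one_lt_exp hx0.ne'
    linarith
  rw [hr2, div_mul_eq_mul_div, div_le_iff₀ hden]
  nlinarith

/-! ### Circular means: neutrality and the `[0, 2π]` convention -/

/-- **A circular-mean-free integrable function is neutral**: `∫ a = 0` (polar coordinates). [folklore] -/
theorem evenArnold_integral_eq_zero_of_circMean {a : EuclideanSpace ℝ (Fin 2) → ℝ}
    (hai : Integrable a)
    (hcirc : ∀ r : ℝ, 0 < r → ∫ θ in (-Real.pi)..Real.pi, a (circlePt r θ) = 0) :
    ∫ x, a x = 0 := by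
  rw [integral_eq_integral_circlePt hai]
  refine setIntegral_eq_zero_of_forall_eq_zero fun ρ hρ => ?_
  simp only [smul_eq_mul]
  rw [integral_const_mul, ← intervalIntegral.integral_of_le (by linarith [Real.pi_pos]),
    hcirc ρ hρ, mul_zero]

/-- The circular means over `[−π, π]` (with `circlePt`) and over `[0, 2π]` (with the explicit
circle point) agree (`2π`-periodicity). [folklore] -/
theorem evenArnold_circMean_zero_two_pi (a : EuclideanSpace ℝ (Fin 2) → ℝ) (r : ℝ) :
    ∫ θ in (0:ℝ)..(2 * Real.pi), a (WithLp.toLp 2 ![r * Real.cos θ, r * Real.sin θ]) =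
      ∫ θ in (-Real.pi)..Real.pi, a (circlePt r θ) := by
  have hper : Periodic (fun θ : ℝ => a (circlePt r θ)) (2 * Real.pi) :=
    (periodic_circlePt r).comp a
  have h := hper.intervalIntegral_add_eq 0 (-Real.pi)
  rw [zero_add, show -Real.pi + 2 * Real.pi = Real.pi by ring] at h
  exact h

/-! ### The explicit coercivity -/

/-- **Explicit coercivity of Arnold's form on even circular-mean-free densities.** For `a ∈ C¹` of
Gaussian class together with its derivative, even, with zero circular means, and `ψ = N ∗ a`:
`a ψ ∈ L¹` and `(3/10) ∫ Φ⁻¹ a² ≤ ∫ Φ⁻¹ a² + ∫ a ψ` (neutrality, the energy identity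
`∫‖∇ψ‖² = −∫ ψ a`, Hardy–Wirtinger `¼`, `Φ|x|² ≤ 14/5`, AM–GM). [folklore] -/
theorem evenArnold_coercive {a ψ : EuclideanSpace ℝ (Fin 2) → ℝ} (ha : ContDiff ℝ 1 a)
    (hab : ∃ (C : ℝ) (N : ℕ), ∀ x, |a x| ≤ C * (1 + ‖x‖) ^ N * Real.exp (-(‖x‖ ^ 2 / 4)) ∧
      ‖fderiv ℝ a x‖ ≤ C * (1 + ‖x‖) ^ N * Real.exp (-(‖x‖ ^ 2 / 4)))
    (heven : ∀ x, a (-x) = a x)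
    (hcirc : ∀ r : ℝ, 0 < r → ∫ θ in (-Real.pi)..Real.pi, a (circlePt r θ) = 0)
    (hψ : ∀ x, ψ x = ∫ y, (2 * Real.pi)⁻¹ * Real.log ‖x - y‖ * a y) :
    Integrable (fun x => a x * ψ x) ∧
      3 / 10 * ∫ x, (kerWeight ‖x‖)⁻¹ * a x ^ 2 ≤
        (∫ x, (kerWeight ‖x‖)⁻¹ * a x ^ 2) + ∫ x, a x * ψ x := by
  have hψf : ψ = fun ξ => ∫ η, (2 * Real.pi)⁻¹ * Real.log ‖ξ - η‖ * a η := funext hψ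
  subst hψf
  obtain ⟨C, N, hC⟩ := hab
  have hgc : ∃ (C : ℝ) (N : ℕ), ∀ x, |a x| ≤ C * (1 + ‖x‖) ^ N * Real.exp (-(‖x‖ ^ 2 / 4)) :=
    ⟨C, N, fun x => (hC x).1⟩
  -- the Gaussian class in the form `|a| + ‖Da‖ ≤ A (1+|η|)^N G`
  have hbound : ∀ η, |a η| + ‖fderiv ℝ a η‖ ≤ (8 * Real.pi * C) * (1 + ‖η‖) ^ N * gaussVortexProfile η := by
    intro η
    obtain ⟨h1, h2⟩ := hC η
    have e : (8 * Real.pi * C) * (1 + ‖η‖) ^ N * gaussVortexProfile η =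
        2 * (C * (1 + ‖η‖) ^ N * Real.exp (-(‖η‖ ^ 2 / 4))) := by
      rw [gaussVortexProfile]
      field_simp
      ring
    rw [e]
    linarith
  have ham : AEStronglyMeasurable a volume := ha.continuous.aestronglyMeasurable
  have hai : Integrable a := (arnold_integrable_of_gc ham hgc).1
  have hneutral : ∫ η, a η = 0 := evenArnold_integral_eq_zero_of_circMean hai hcirc
  have hcirc' : ∀ r, 0 < r →
      ∫ θ in (0:ℝ)..(2 * Real.pi), a (WithLp.toLp 2 ![r * Real.cos θ, r * Real.sin θ]) = 0 :=
    fun r hr => by rw [evenArnold_circMean_zero_two_pi, hcirc r hr]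
  have hlp := logPotential_neutral_energy N (8 * Real.pi * C) a ha hbound hneutral heven hcirc'
  obtain ⟨hψ1, hψe, hψm, hψgrad, hψg, henergy⟩ := hlp
  set ψ : EuclideanSpace ℝ (Fin 2) → ℝ :=
    fun ξ => ∫ η, (2 * Real.pi)⁻¹ * Real.log ‖ξ - η‖ * a η with hψdef
  obtain ⟨hHW1, hHW2⟩ := hardyWirtinger_even ψ hψ1 hψe hψm hψgrad
  have hA := arnold_integrable_inv_kerWeight_mul_sq ham hgc
  -- pointwise absorption off the origin: `−ψ a ≤ 2ψ²/r² + (7/20) Φ⁻¹ a²`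
  have hae : ∀ᵐ ξ ∂(volume : Measure (EuclideanSpace ℝ (Fin 2))), ξ ≠ 0 := by
    rw [ae_iff]; simp
  have hpt : ∀ ξ : EuclideanSpace ℝ (Fin 2), ξ ≠ 0 →
      -(ψ ξ * a ξ) ≤ 2 * (ψ ξ ^ 2 / ‖ξ‖ ^ 2) + 7 / 20 * ((kerWeight ‖ξ‖)⁻¹ * a ξ ^ 2) := by
    intro ξ hξ
    have hr : 0 < ‖ξ‖ := norm_pos_iff.2 hξ
    have hΦ := kerWeight_pos ‖ξ‖
    have h1 : -(ψ ξ * a ξ) ≤ |ψ ξ| * |a ξ| := by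
      rw [← abs_mul]; exact neg_le_abs _
    have h2 := abs_mul_le_two_sq_div_add (ψ ξ) (a ξ) ‖ξ‖ hr
    have hsc := evenArnold_kerWeight_mul_sq_le ξ
    have h3 : ‖ξ‖ ^ 2 * a ξ ^ 2 / 8 ≤ 7 / 20 * ((kerWeight ‖ξ‖)⁻¹ * a ξ ^ 2) := by
      have e : ‖ξ‖ ^ 2 * a ξ ^ 2 = (kerWeight ‖ξ‖ * ‖ξ‖ ^ 2) * ((kerWeight ‖ξ‖)⁻¹ * a ξ ^ 2) := by
        field_simp
      rw [e]
      have hnn : 0 ≤ (kerWeight ‖ξ‖)⁻¹ * a ξ ^ 2 := by positivity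
      nlinarith [mul_le_mul_of_nonneg_right hsc hnn]
    linarith
  have hP : ∫ ξ, ‖gradient ψ ξ‖ ^ 2 ≤
      2 * (∫ ξ, ψ ξ ^ 2 / ‖ξ‖ ^ 2) + 7 / 20 * ∫ ξ, (kerWeight ‖ξ‖)⁻¹ * a ξ ^ 2 := by
    rw [henergy, ← integral_neg, ← integral_const_mul, ← integral_const_mul,
      ← integral_add (hHW1.const_mul 2) (hA.const_mul _)]
    exact integral_mono_ae hψg.neg ((hHW1.const_mul 2).add (hA.const_mul _))
      (hae.mono fun ξ hξ => hpt ξ hξ)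
  -- bookkeeping: `P ≤ P/2 + (7/20) A`, `∫ a ψ = −P`
  have hcomm : ∫ x, a x * ψ x = ∫ ξ, ψ ξ * a ξ :=
    integral_congr_ae (Eventually.of_forall fun x => mul_comm _ _)
  refine ⟨hψg.congr (Eventually.of_forall fun x => mul_comm _ _), ?_⟩
  rw [hcomm]
  linarith [hP, hHW2]

/-- **The norm bound behind the even symmetrizer estimate.** If `g ∈ C¹` is even, of Gaussian class
with its derivative, with zero circular means, `ψ_g = N ∗ g`, and `F = g + Φ ψ_g = (I − K̃)g` is a
measurable Gaussian-class function, then `‖g‖_{L²(Φ⁻¹)} ≤ (10/3) ‖F‖_{L²(Φ⁻¹)}`: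
`(3/10)‖g‖² ≤ ∫ Φ⁻¹g² + ∫ g ψ_g = ∫ Φ⁻¹ g F ≤ ‖g‖ ‖F‖` (weighted Cauchy–Schwarz). [folklore] -/
theorem evenArnold_kerNorm_le {g ψg F : EuclideanSpace ℝ (Fin 2) → ℝ} (hg : ContDiff ℝ 1 g)
    (hgb : ∃ (C : ℝ) (N : ℕ), ∀ x, |g x| ≤ C * (1 + ‖x‖) ^ N * Real.exp (-(‖x‖ ^ 2 / 4)) ∧
      ‖fderiv ℝ g x‖ ≤ C * (1 + ‖x‖) ^ N * Real.exp (-(‖x‖ ^ 2 / 4)))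
    (hge : ∀ x, g (-x) = g x)
    (hgcirc : ∀ r : ℝ, 0 < r → ∫ θ in (-Real.pi)..Real.pi, g (circlePt r θ) = 0)
    (hψg : ∀ x, ψg x = ∫ y, (2 * Real.pi)⁻¹ * Real.log ‖x - y‖ * g y)
    (hFm : AEStronglyMeasurable F volume)
    (hFg : ∃ (C : ℝ) (N : ℕ), ∀ x, |F x| ≤ C * (1 + ‖x‖) ^ N * Real.exp (-(‖x‖ ^ 2 / 4)))
    (hF : ∀ x, g x + kerWeight ‖x‖ * ψg x = F x) :
    Real.sqrt (∫ x, (kerWeight ‖x‖)⁻¹ * g x ^ 2) ≤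
      10 / 3 * Real.sqrt (∫ x, (kerWeight ‖x‖)⁻¹ * F x ^ 2) := by
  obtain ⟨-, hfact⟩ := evenArnold_coercive hg hgb hge hgcirc hψg
  have hgm : AEStronglyMeasurable g volume := hg.continuous.aestronglyMeasurable
  have hgg : ∃ (C : ℝ) (N : ℕ), ∀ x, |g x| ≤ C * (1 + ‖x‖) ^ N * Real.exp (-(‖x‖ ^ 2 / 4)) := by
    obtain ⟨C, N, hC⟩ := hgb
    exact ⟨C, N, fun x => (hC x).1⟩
  have hΦpos : ∀ x : EuclideanSpace ℝ (Fin 2), 0 < kerWeight ‖x‖ := fun x => kerWeight_pos _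
  have hginv : ∀ x : EuclideanSpace ℝ (Fin 2), 0 ≤ (kerWeight ‖x‖)⁻¹ := fun x =>
    inv_nonneg.2 (hΦpos x).le
  have hginvm : AEStronglyMeasurable (fun x : EuclideanSpace ℝ (Fin 2) => (kerWeight ‖x‖)⁻¹) volume :=
    ((continuous_kerWeight.comp continuous_norm).inv₀ fun x => (kerWeight_pos _).ne').aestronglyMeasurable
  have hgΦ := arnold_integrable_inv_kerWeight_mul_sq hgm hgg
  have hFΦ := arnold_integrable_inv_kerWeight_mul_sq hFm hFg
  obtain ⟨hprod, hcs⟩ := abs_integral_weight_mul_mul_le (μ := volume) hginv hginvm hgm hFm hgΦ hFΦ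
  -- the right-hand side of the coercivity is `∫ Φ⁻¹ g F`
  have hptF : ∀ x, (kerWeight ‖x‖)⁻¹ * g x ^ 2 + g x * ψg x = (kerWeight ‖x‖)⁻¹ * (g x * F x) := by
    intro x
    rw [← hF x]
    have hΦ := (hΦpos x).ne'
    generalize ψg x = t
    field_simp
  have hgψ : Integrable fun x => g x * ψg x := by
    refine (hprod.sub hgΦ).congr (Eventually.of_forall fun x => ?_)
    simp only [Pi.sub_apply]
    linarith [hptF x]
  have hrhs : (∫ x, (kerWeight ‖x‖)⁻¹ * g x ^ 2) + ∫ x, g x * ψg x =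
      ∫ x, (kerWeight ‖x‖)⁻¹ * (g x * F x) := by
    rw [← integral_add hgΦ hgψ]
    exact integral_congr_ae (Eventually.of_forall hptF)
  set G : ℝ := Real.sqrt (∫ x, (kerWeight ‖x‖)⁻¹ * g x ^ 2) with hG
  set Fn : ℝ := Real.sqrt (∫ x, (kerWeight ‖x‖)⁻¹ * F x ^ 2) with hFn
  have hG0 : 0 ≤ G := Real.sqrt_nonneg _
  have hFn0 : 0 ≤ Fn := Real.sqrt_nonneg _
  have hG2 : G ^ 2 = ∫ x, (kerWeight ‖x‖)⁻¹ * g x ^ 2 :=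
    Real.sq_sqrt (integral_nonneg fun x => mul_nonneg (hginv x) (sq_nonneg _))
  have hkey : 3 / 10 * G ^ 2 ≤ G * Fn := by
    rw [hG2]
    calc 3 / 10 * ∫ x, (kerWeight ‖x‖)⁻¹ * g x ^ 2
        ≤ (∫ x, (kerWeight ‖x‖)⁻¹ * g x ^ 2) + ∫ x, g x * ψg x := hfact
      _ = ∫ x, (kerWeight ‖x‖)⁻¹ * (g x * F x) := hrhs
      _ ≤ |∫ x, (kerWeight ‖x‖)⁻¹ * (g x * F x)| := le_abs_self _
      _ ≤ G * Fn := hcs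
  rcases hG0.eq_or_lt with hG00 | hGpos
  · rw [← hG00]; positivity
  · have : 3 / 10 * G ≤ Fn := by
      refine le_of_mul_le_mul_right ?_ hGpos
      nlinarith [hkey]
    linarith

/-! ### The registered tools stub -/

/-- **Registered tools stub `stub_evenArnoldToolsA`** (helpers for `stub_evenSymmetrizerBoundedBelow`,
line `Sketch` of crux `CoreLinearInvertibility`, stmt-NavierStokesRegularity-17973): the scalar bound
`Φ(|x|)|x|² ≤ 14/5`, the EXPLICIT coercivity `(3/10)∫Φ⁻¹a² ≤ ∫Φ⁻¹a² + ∫ a ψ_a` of Arnold's form on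
even circular-mean-free `C¹` Gaussian-class densities, and the resulting bound
`‖g‖_{L²(Φ⁻¹)} ≤ (10/3)‖(I − K̃)g‖_{L²(Φ⁻¹)}`. [folklore] -/
theorem stub_evenArnoldToolsA :
    (∀ ξ : EuclideanSpace ℝ (Fin 2), kerWeight ‖ξ‖ * ‖ξ‖ ^ 2 ≤ 14 / 5) ∧
    (∀ a ψ : EuclideanSpace ℝ (Fin 2) → ℝ, ContDiff ℝ 1 a →
      (∃ (C : ℝ) (N : ℕ), ∀ x, |a x| ≤ C * (1 + ‖x‖) ^ N * Real.exp (-(‖x‖ ^ 2 / 4)) ∧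
        ‖fderiv ℝ a x‖ ≤ C * (1 + ‖x‖) ^ N * Real.exp (-(‖x‖ ^ 2 / 4))) →
      (∀ x, a (-x) = a x) →
      (∀ r : ℝ, 0 < r → ∫ θ in (-Real.pi)..Real.pi, a (circlePt r θ) = 0) →
      (∀ x, ψ x = ∫ y, (2 * Real.pi)⁻¹ * Real.log ‖x - y‖ * a y) →
      Integrable (fun x => a x * ψ x) ∧
        3 / 10 * ∫ x, (kerWeight ‖x‖)⁻¹ * a x ^ 2 ≤
          (∫ x, (kerWeight ‖x‖)⁻¹ * a x ^ 2) + ∫ x, a x * ψ x) ∧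
    (∀ g ψg F : EuclideanSpace ℝ (Fin 2) → ℝ, ContDiff ℝ 1 g →
      (∃ (C : ℝ) (N : ℕ), ∀ x, |g x| ≤ C * (1 + ‖x‖) ^ N * Real.exp (-(‖x‖ ^ 2 / 4)) ∧
        ‖fderiv ℝ g x‖ ≤ C * (1 + ‖x‖) ^ N * Real.exp (-(‖x‖ ^ 2 / 4))) →
      (∀ x, g (-x) = g x) →
      (∀ r : ℝ, 0 < r → ∫ θ in (-Real.pi)..Real.pi, g (circlePt r θ) = 0) →
      (∀ x, ψg x = ∫ y, (2 * Real.pi)⁻¹ * Real.log ‖x - y‖ * g y) →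
      AEStronglyMeasurable F volume →
      (∃ (C : ℝ) (N : ℕ), ∀ x, |F x| ≤ C * (1 + ‖x‖) ^ N * Real.exp (-(‖x‖ ^ 2 / 4))) →
      (∀ x, g x + kerWeight ‖x‖ * ψg x = F x) →
      Real.sqrt (∫ x, (kerWeight ‖x‖)⁻¹ * g x ^ 2) ≤
        10 / 3 * Real.sqrt (∫ x, (kerWeight ‖x‖)⁻¹ * F x ^ 2)) :=
  ⟨evenArnold_kerWeight_mul_sq_le,
    fun _ _ ha hab heven hcirc hψ => evenArnold_coercive ha hab heven hcirc hψ,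
    fun _ _ _ hg hgb hge hgcirc hψg hFm hFg hF => evenArnold_kerNorm_le hg hgb hge hgcirc hψg hFm hFg hF⟩

end Summit.NavierStokesRegularity.NavierStokesRegularity.Theorems
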